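import Literature.ComputerArithmetic.BoldoJeannerodMelquiondMuller2023.Ulp
import Mathlib.Tactic.Linarith
import Mathlib.Tactic.NormNum
import Mathlib.Tactic.Positivity
import Mathlib.Tactic.Ring

/-!
# ORIENT2D, the tails-zero exit: the grid-pinning step of the `det = 0 ⟹ t_A = 0` blueprint

NEW WORK in the sense of this development (statement and proof ours; no published counterpart
claimed).  Context: `Orient2dEstimateZero.orient2d_tailsZero_eq_zero` reduces the last open case of
the specification of Shewchuk's `orient2d` (a `0` answered at the tails-zero exit of `orient2dadapt`
while the true determinant is nonzero) to one rigid configuration of the TWO-TWO-DIFF block: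
`B₂ = 0`, `B₀ ⊕ B₁ = −B₃`, so that `B₃ = _j + _i'` exactly, where `_j > 0` and `_i' < 0` are the two
floats entering the block's top TWO-SUM, and `|B₃|` is below `ulp(_i')`.  The blueprint recorded in
the unit's HANDOFF (steps S0–S5) derives a contradiction for `p ≥ 3`; its purely arithmetical heart
is the PINNING step S2–S3, proved here once and for all:

* `grid_pin_int` — integers: if `2^(p−1) ≤ J < 2^p`, `2^(p−1) ≤ Y`, `d ≥ 1` and
  `0 < |Y·2^d − J| < 2^d`, then `d = 1`, `Y = 2^(p−1)`, `J = 2^p − 1`;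
* `grid_pin` — the rational form used by the blueprint: two positive floats in canonical position,
  `j = J·2^a`, `y = Y·2^b` (`2^(p−1) ≤ J < 2^p`, `2^(p−1) ≤ Y`; so `ulp j = 2^a`), with `j ≠ y`
  and `|j − y| < 2^b`, satisfy `b = a + 1`, `y = 2^(p−1)·2^b` (a power of two, the bottom of its
  binade) and `j = y − 2^a` (its predecessor), hence `j − y = −2^a`.  (If instead the first grid is
  the coarser one, `j − y` is a nonzero multiple of `2^b`, which the bound excludes.)
* `exists_canonical_of_normal` (a positive normal float is `K·ulp` with `2^(p−1) ≤ K < 2^p`) and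
  `grid_pin_float` — the same for two positive normal floats `j ≠ y` with `|j − y| < ulp(y)`:
  `ulp(y) = 2·ulp(j)`, `y = 2^(p−1)·ulp(y)`, `j − y = −ulp(j)`.

What remains for the conjecture (next files): S0/S1 (size bookkeeping putting `_j`, `−_i'` in this
position with `|B₃| < ulp(_i')`), S4 (the subtrahend `b` is `2^E` or `2^E − V`) and S5 (the final
half-ulp contradiction, `p ≥ 3`).
-/

namespace Summit.Ventures.CertifiedArithmetic.Expansions

/-- **Grid pinning, integer form.**  `2^(p−1) ≤ J < 2^p`, `2^(p−1) ≤ Y`, `1 ≤ d`,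
`Y·2^d ≠ J` and `|Y·2^d − J| < 2^d` force `d = 1`, `Y = 2^(p−1)` and `J = 2^p − 1`. -/
theorem grid_pin_int {p d : ℕ} (hp : 2 ≤ p) (hd : 1 ≤ d) {J Y : ℤ}
    (hJl : (2 : ℤ) ^ (p - 1) ≤ J) (hJu : J < (2 : ℤ) ^ p)
    (hYl : (2 : ℤ) ^ (p - 1) ≤ Y)
    (hne : Y * 2 ^ d ≠ J) (hlt : |Y * 2 ^ d - J| < (2 : ℤ) ^ d) :
    d = 1 ∧ Y = (2 : ℤ) ^ (p - 1) ∧ J = (2 : ℤ) ^ p - 1 := by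
  have hp2 : (2 : ℤ) ^ p = 2 * 2 ^ (p - 1) := by
    rw [← pow_succ']; congr 1; omega
  have hd2 : (2 : ℤ) ^ d = 2 * 2 ^ (d - 1) := by
    rw [← pow_succ']; congr 1; omega
  have hd1 : (1 : ℤ) ≤ 2 ^ (d - 1) := one_le_pow₀ (by norm_num)
  have hp1 : (2 : ℤ) ≤ 2 ^ (p - 1) := by
    calc (2 : ℤ) = 2 ^ 1 := by norm_num
      _ ≤ 2 ^ (p - 1) := pow_le_pow_right₀ (by norm_num) (by omega)
  -- `J < 2^p = 2·2^(p−1) ≤ 2Y ≤ Y·2^d`, so the difference is positive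
  have hpos : 0 < Y * 2 ^ d - J := by
    rw [hd2]; nlinarith
  rw [abs_of_pos hpos] at hlt
  by_cases hd' : d = 1
  · subst hd'
    refine ⟨rfl, ?_⟩
    have hlt1 : Y * 2 - J < 2 := by simpa using hlt
    have hpos1 : 0 < Y * 2 - J := by simpa using hpos
    have h1 : Y * 2 - J = 1 := by omega
    constructor <;> nlinarith
  · exfalso
    have hd2' : (2 : ℤ) ≤ 2 ^ (d - 1) := by
      calc (2 : ℤ) = 2 ^ 1 := by norm_num
        _ ≤ 2 ^ (d - 1) := pow_le_pow_right₀ (by norm_num) (by omega)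
    -- `Y·2^d − J ≥ 2^(p−1)·2^d − 2·2^(p−1) = 2·2^(p−1)·(2^(d−1) − 1) ≥ 2·2^(d−1)·… ≥ 2^d`
    have hge : (2 : ℤ) ^ d ≤ Y * 2 ^ d - J := by
      rw [hd2]
      rw [hp2] at hJu
      nlinarith
    linarith

/-- **Grid pinning, float form** (the S2–S3 step of the tails-zero blueprint).  Two positive floats
`j = J·2^a` in canonical position (`2^(p−1) ≤ J < 2^p`, so `ulp j = 2^a`) and `y = Y·2^b` with
`2^(p−1) ≤ Y` (e.g. canonical, `ulp y = 2^b`), `j ≠ y` and `|j − y| < 2^b`: then `b = a + 1`, `y = 2^(p−1)·2^b` is the bottom of its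
binade, and `j = y − 2^a` is the float just below it; in particular `j − y = −2^a`. -/
theorem grid_pin {p : ℕ} (hp : 2 ≤ p) {J Y a b : ℤ}
    (hJl : (2 : ℤ) ^ (p - 1) ≤ J) (hJu : J < (2 : ℤ) ^ p)
    (hYl : (2 : ℤ) ^ (p - 1) ≤ Y)
    (hne : (J : ℚ) * 2 ^ a ≠ (Y : ℚ) * 2 ^ b)
    (hlt : |(J : ℚ) * 2 ^ a - (Y : ℚ) * 2 ^ b| < (2 : ℚ) ^ b) :
    b = a + 1 ∧ Y = (2 : ℤ) ^ (p - 1) ∧ J = (2 : ℤ) ^ p - 1 ∧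
      (J : ℚ) * 2 ^ a - (Y : ℚ) * 2 ^ b = -(2 : ℚ) ^ a := by
  have h2 : (0 : ℚ) < 2 := by norm_num
  have h2a : (0 : ℚ) < 2 ^ a := zpow_pos h2 a
  have h2b : (0 : ℚ) < 2 ^ b := zpow_pos h2 b
  rcases le_or_gt b a with hba | hab
  · -- coarser first grid: `j − y` is a nonzero multiple of `2^b`
    exfalso
    obtain ⟨d, hd⟩ := Int.eq_ofNat_of_zero_le (by omega : 0 ≤ a - b)
    have ha : (2 : ℚ) ^ a = 2 ^ (d : ℕ) * 2 ^ b := by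
      rw [show a = (d : ℤ) + b by omega, zpow_add₀ (ne_of_gt h2), zpow_natCast]
    have hq : (J : ℚ) * 2 ^ a - (Y : ℚ) * 2 ^ b = ((J * 2 ^ d - Y : ℤ) : ℚ) * 2 ^ b := by
      rw [ha]; push_cast; ring
    have hne' : J * 2 ^ d - Y ≠ 0 := by
      intro h0
      apply hne
      have : (J : ℚ) * 2 ^ a - (Y : ℚ) * 2 ^ b = 0 := by rw [hq, h0]; simp
      linarith
    have h1 : (1 : ℚ) ≤ |((J * 2 ^ d - Y : ℤ) : ℚ)| := by
      rw [← Int.cast_abs]; exact_mod_cast Int.one_le_abs hne'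
    rw [hq, abs_mul, abs_of_pos h2b] at hlt
    nlinarith
  · -- finer first grid: `b = a + d`, `d ≥ 1`; reduce to the integer lemma
    obtain ⟨d, hd⟩ := Int.eq_ofNat_of_zero_le (by omega : 0 ≤ b - a)
    have hd1 : 1 ≤ d := by omega
    have hb : (2 : ℚ) ^ b = 2 ^ (d : ℕ) * 2 ^ a := by
      rw [show b = (d : ℤ) + a by omega, zpow_add₀ (ne_of_gt h2), zpow_natCast]
    have hq : (J : ℚ) * 2 ^ a - (Y : ℚ) * 2 ^ b = -(((Y * 2 ^ d - J : ℤ) : ℚ) * 2 ^ a) := by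
      rw [hb]; push_cast; ring
    have hne' : Y * 2 ^ d ≠ J := by
      intro h0
      apply hne
      have h0' : ((Y * 2 ^ d - J : ℤ) : ℚ) = 0 := by exact_mod_cast (sub_eq_zero.mpr h0)
      have : (J : ℚ) * 2 ^ a - (Y : ℚ) * 2 ^ b = 0 := by rw [hq, h0']; simp
      linarith
    have hlt' : |Y * 2 ^ d - J| < (2 : ℤ) ^ d := by
      rw [hq, abs_neg, abs_mul, abs_of_pos h2a, hb] at hlt
      have h3 : (|((Y * 2 ^ d - J : ℤ) : ℚ)|) < ((2 : ℚ) ^ (d : ℕ)) := by nlinarith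
      rw [← Int.cast_abs] at h3
      exact_mod_cast h3
    obtain ⟨rfl, hY, hJ⟩ := grid_pin_int hp hd1 hJl hJu hYl hne' hlt'
    refine ⟨by omega, hY, hJ, ?_⟩
    rw [hq, hY, hJ]
    have hp2 : (2 : ℚ) ^ p = 2 * 2 ^ (p - 1) := by
      rw [← pow_succ']; congr 1; omega
    push_cast
    rw [hp2]; ring

open Literature.ComputerArithmetic.JeannerodRump2018
open Literature.ComputerArithmetic.BoldoJeannerodMelquiondMuller2023

/-- Canonical representation of a positive NORMAL float: `t = K·ulp(t)`, `ulp(t) = 2^a`,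
`2^(p−1) ≤ K < 2^p`. -/
theorem exists_canonical_of_normal {p : ℕ} {emin : ℤ} (hp : 1 ≤ p) {t : ℚ} (ht : IsFloat p emin t)
    (h0 : 0 < t) (hn : (2 : ℚ) ^ (emin + p - 1) ≤ t) :
    ∃ K a : ℤ, t = (K : ℚ) * 2 ^ a ∧ ulp p emin t = (2 : ℚ) ^ a ∧
      (2 : ℤ) ^ (p - 1) ≤ K ∧ K < (2 : ℤ) ^ p := by
  obtain ⟨a, -, hulp⟩ := exists_ulp_eq_two_zpow (p := p) (emin := emin) t
  obtain ⟨K, hK⟩ := exists_eq_int_mul_ulp_of_isFloat ht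
  have h2a : (0 : ℚ) < 2 ^ a := zpow_pos (by norm_num) a
  rw [hulp] at hK
  refine ⟨K, a, hK, hulp, ?_, ?_⟩
  · -- `2^(p−1)·ulp(t) ≤ t`
    have h := ulp_le_of_normal (emin := emin) hp (t := t) (by rwa [abs_of_pos h0])
    rw [hulp, abs_of_pos h0, le_div_iff₀ (by positivity), hK] at h
    have h' : ((2 : ℤ) ^ (p - 1) : ℚ) * 2 ^ a ≤ (K : ℚ) * 2 ^ a := by push_cast; linarith
    exact_mod_cast le_of_mul_le_mul_right h' h2a
  · -- `t < 2^p·ulp(t)`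
    have h := abs_lt_two_pow_mul_ulp (p := p) (emin := emin) t
    rw [hulp, abs_of_pos h0, hK] at h
    have h' : (K : ℚ) * 2 ^ a < ((2 : ℤ) ^ p : ℤ) * 2 ^ a := by push_cast; linarith
    exact_mod_cast lt_of_mul_lt_mul_right h' h2a.le

/-- **Grid pinning for floats.**  Two positive normal floats `j ≠ y` with `|j − y| < ulp(y)`:
then `ulp(y) = 2·ulp(j)`, `y = 2^(p−1)·ulp(y)` is the bottom of its binade and `j = y − ulp(j)` is
its predecessor.  (This is where a `det = 0` at the tails-zero exit of `orient2dadapt` pins the top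
TWO-SUM of the block: `_j = 2^E − V`, `_i' = −2^E`, `B₃ = −V`.) -/
theorem grid_pin_float {p : ℕ} {emin : ℤ} (hp : 2 ≤ p) {j y : ℚ} (hj : IsFloat p emin j)
    (hy : IsFloat p emin y) (hj0 : 0 < j) (hy0 : 0 < y) (hjn : (2 : ℚ) ^ (emin + p - 1) ≤ j)
    (hyn : (2 : ℚ) ^ (emin + p - 1) ≤ y) (hne : j ≠ y) (hlt : |j - y| < ulp p emin y) :
    ulp p emin y = 2 * ulp p emin j ∧ y = 2 ^ (p - 1) * ulp p emin y ∧
      j - y = -ulp p emin j := by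
  have hp1 : 1 ≤ p := le_trans (by norm_num) hp
  obtain ⟨J, a, hJ, hulpj, hJl, hJu⟩ := exists_canonical_of_normal hp1 hj hj0 hjn
  obtain ⟨Y, b, hY, hulpy, hYl, -⟩ := exists_canonical_of_normal hp1 hy hy0 hyn
  rw [hulpy] at hlt
  rw [hJ, hY] at hne hlt
  obtain ⟨hb, hYe, -, hdiff⟩ := grid_pin hp hJl hJu hYl hne hlt
  refine ⟨?_, ?_, ?_⟩
  · rw [hulpy, hulpj, hb, zpow_add₀ (by norm_num : (2 : ℚ) ≠ 0), zpow_one, mul_comm]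
  · rw [hulpy, hY, hYe]; push_cast; ring
  · rw [hulpj, hJ, hY, hdiff]

end Summit.Ventures.CertifiedArithmetic.Expansions
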